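import Summits.QuantumAdvantage.AdviceFreeQNC0.TransferOps
import Summits.QuantumAdvantage.AdviceFreeQNC0.WalkTransport
import HarnessLib

/-!
# Cell qa-qnc0 (rung F-Q2-odd, `p = 3`): the transfer-matrix form of the fixed-bell game (ROUND-15 §9.7 (i))

Planner qa-qnc0-p1 g17, route DWalkThree, support `RingFixedBellsSharp3` (stmt-QuantumAdvantage-22487), dense half,
path-sum layer, in the cell's u-coordinates (`WalkTransport`): for `u ∈ {0,1}^n` the walk position after `g` steps is
`pos_g(u) = g + #{i < g : u_i = 1}` (steps `+1`/`+2 ≡ -1` in `ℤ/3`), and the ring condition of `ringWinU (n+2)` at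
cut `g` reads `2 + pos_n + pos_g ≢ 0`.

* `pathSum` — **path-sum identity**: for every start state `E`, final weight `v` and bell set,
  `Σ_u (∏_{g<l} bellfactor_{a+g}(E + pos_g u)) · v(E + pos_l u) = 2^l · (seg bell a l v)(E)`
  (induction on `l`, peeling the first step: `Fin.cons`);
* `signedSum_eq` — the signed count `Σ_u ∏_{g ≤ n} bellfactor_g(2 + pos_n + pos_g)` equals
  `2^n · Σ_E (seg bell 0 n v_E)(E)` with `v_E = bellfactor_n · 1_{2E+1}` (the twisted boundary condition
  `d_0 = E`, `d_n = 2E + 1`).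

WHAT THIS IS NOT: the contraction estimate and the count are `FixedBellsDense.lean`; separation NOT moved.
-/

noncomputable section

namespace Summit.QuantumAdvantage.AdviceFreeQNC0

namespace TransferWalk

open Finset

variable {n : ℕ}

/-! ### The walk -/

/-- Walk position after `g` steps, in `ℤ/3`: `g + #{i < g : u_i = 1}`. -/
def posZ (u : Fin n → Bool) (g : ℕ) : ZMod 3 := ((g + wtPrefix u g : ℕ) : ZMod 3)

/-- The weight of cut `k` at state `d`: the bell factor if `k` carries a bell, else `1`. -/
def bfz (bell : ℕ → Bool) (k : ℕ) (d : ZMod 3) : ℝ := if bell k then fz d else 1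

/-- `bfz² ≤ 1`. -/
theorem bfz_sq_le (bell : ℕ → Bool) (k : ℕ) (d : ZMod 3) : bfz bell k d ^ 2 ≤ 1 := by
  unfold bfz; split_ifs
  · exact fz_sq_le d
  · norm_num

/-- No `1`s before step `0`. -/
theorem wtPrefix_zero (u : Fin n → Bool) : wtPrefix u 0 = 0 := by
  unfold wtPrefix; simp

/-- `pos_0 = 0`. -/
theorem posZ_zero (u : Fin n → Bool) : posZ u 0 = 0 := by
  unfold posZ; rw [wtPrefix_zero]; simp

/-- Peeling the first step: `#{i < g+1 : (b :: u)_i} = [b] + #{i < g : u_i}`. -/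
theorem wtPrefix_cons_succ (b : Bool) (u : Fin n → Bool) (g : ℕ) :
    wtPrefix (Fin.cons b u : Fin (n + 1) → Bool) (g + 1) = (if b then 1 else 0) + wtPrefix u g := by
  unfold wtPrefix
  rw [Finset.card_filter, Finset.card_filter, Fin.sum_univ_succ]
  simp only [Fin.cons_zero, Fin.cons_succ, Fin.val_zero, Fin.val_succ, Nat.zero_lt_succ, true_and,
    add_lt_add_iff_right]

/-- Peeling the first step: `pos_{g+1}(b :: u) = step(b) + pos_g(u)`, `step(0) = 1`, `step(1) = 2`. -/
theorem posZ_cons_succ (b : Bool) (u : Fin n → Bool) (g : ℕ) :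
    posZ (Fin.cons b u : Fin (n + 1) → Bool) (g + 1) = (if b then (2 : ZMod 3) else 1) + posZ u g := by
  unfold posZ
  rw [wtPrefix_cons_succ]
  cases b
  · simp only [if_false, Bool.false_eq_true, Nat.zero_add]; push_cast; ring
  · simp only [if_true]; push_cast; ring

/-! ### The path-sum identity -/

/-- **Path sum.**  `Σ_u (∏_{g<l} bfz_{a+g}(E + pos_g u))·v(E + pos_l u) = 2^l·(seg bell a l v)(E)`. -/
theorem pathSum (bell : ℕ → Bool) : ∀ (l a : ℕ) (E : ZMod 3) (v : ZMod 3 → ℝ),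
    ∑ u : Fin l → Bool, (∏ g ∈ range l, bfz bell (a + g) (E + posZ u g)) * v (E + posZ u l) =
      2 ^ l * seg bell a l v E
  | 0, a, E, v => by
    rw [Fintype.sum_subsingleton _ (fun i => Fin.elim0 i)]
    simp [posZ_zero, seg]
  | l + 1, a, E, v => by
    -- split off the first bit
    have hsplit : ∑ u : Fin (l + 1) → Bool,
        (∏ g ∈ range (l + 1), bfz bell (a + g) (E + posZ u g)) * v (E + posZ u (l + 1)) =
        ∑ b : Bool, ∑ u : Fin l → Bool,
          (∏ g ∈ range (l + 1), bfz bell (a + g) (E + posZ (Fin.cons b u : Fin (l + 1) → Bool) g)) *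
            v (E + posZ (Fin.cons b u : Fin (l + 1) → Bool) (l + 1)) := by
      rw [← Fintype.sum_prod_type']
      exact (Fintype.sum_equiv (Fin.consEquiv fun _ => Bool) _ _ fun p => rfl).symm
    rw [hsplit]
    -- the summand for `u = b :: u'`
    have hterm : ∀ (b : Bool) (u : Fin l → Bool),
        (∏ g ∈ range (l + 1), bfz bell (a + g) (E + posZ (Fin.cons b u : Fin (l + 1) → Bool) g)) *
            v (E + posZ (Fin.cons b u : Fin (l + 1) → Bool) (l + 1)) =
          bfz bell a E * ((∏ g ∈ range l, bfz bell (a + 1 + g) ((E + (if b then (2 : ZMod 3) else 1)) + posZ u g)) *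
            v ((E + (if b then (2 : ZMod 3) else 1)) + posZ u l)) := by
      intro b u
      rw [Finset.prod_range_succ']
      have h0 : bfz bell (a + 0) (E + posZ (Fin.cons b u : Fin (l + 1) → Bool) 0) = bfz bell a E := by
        rw [posZ_zero]; simp only [add_zero]
      have hl : posZ (Fin.cons b u : Fin (l + 1) → Bool) (l + 1) = (if b then (2 : ZMod 3) else 1) + posZ u l :=
        posZ_cons_succ b u l
      have hg : ∀ g ∈ range l, bfz bell (a + (g + 1)) (E + posZ (Fin.cons b u : Fin (l + 1) → Bool) (g + 1)) =
          bfz bell (a + 1 + g) ((E + (if b then (2 : ZMod 3) else 1)) + posZ u g) := by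
        intro g _
        have hg1 : posZ (Fin.cons b u : Fin (l + 1) → Bool) (g + 1) = (if b then (2 : ZMod 3) else 1) + posZ u g :=
          posZ_cons_succ b u g
        simp only [hg1, show a + (g + 1) = a + 1 + g by omega, add_assoc]
      simp only [h0, hl, Finset.prod_congr rfl hg, add_assoc]
      ring
    simp only [hterm]
    rw [Fintype.sum_bool]
    simp only [if_true, if_false, Bool.false_eq_true, ← Finset.mul_sum]
    rw [pathSum bell l (a + 1) (E + 2) v, pathSum bell l (a + 1) (E + 1) v]
    -- the cut operator at `a`
    show _ = 2 ^ (l + 1) * Aop bell a (seg bell (a + 1) l v) E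
    rw [Aop_apply]
    unfold bfz Pop
    ring

/-! ### The twisted boundary condition -/

/-- The final weight for start state `E`: the last cut's factor on the state `2E + 1`, zero elsewhere. -/
def vE (bell : ℕ → Bool) (n : ℕ) (E : ZMod 3) : ZMod 3 → ℝ := fun d => if d = 2 * E + 1 then bfz bell n d else 0

/-- `‖v_E‖² ≤ 1`. -/
theorem nsq_vE_le (bell : ℕ → Bool) (n : ℕ) (E : ZMod 3) : nsq (vE bell n E) ≤ 1 := by
  have h3 : nsq (vE bell n E) = ∑ d : ZMod 3, vE bell n E d ^ 2 := by
    unfold nsq; exact (Fin.sum_univ_three (fun d => vE bell n E d ^ 2)).symm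
  rw [h3]
  have h : ∀ d : ZMod 3, vE bell n E d ^ 2 = if d = 2 * E + 1 then bfz bell n d ^ 2 else 0 := by
    intro d; unfold vE; split_ifs <;> simp
  simp only [h, Finset.sum_ite_eq', mem_univ, if_true]
  exact bfz_sq_le bell n _

/-- In `ℤ/3`: `E + p = 2E + 1 ↔ E = p + 2`. -/
theorem twist_iff (E p : ZMod 3) : E + p = 2 * E + 1 ↔ E = p + 2 := by
  revert E p; decide

/-- **The signed count as a twisted trace.**
`Σ_u ∏_{g ≤ n} bfz_g(2 + pos_n u + pos_g u) = 2^n · Σ_E (seg bell 0 n v_E)(E)`. -/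
theorem signedSum_eq (bell : ℕ → Bool) (n : ℕ) :
    ∑ u : Fin n → Bool, ∏ g ∈ range (n + 1), bfz bell g (2 + posZ u n + posZ u g) =
      2 ^ n * ∑ E : ZMod 3, seg bell 0 n (vE bell n E) E := by
  -- insert the start state `E = pos_n + 2`
  have hins : ∀ u : Fin n → Bool, ∏ g ∈ range (n + 1), bfz bell g (2 + posZ u n + posZ u g) =
      ∑ E : ZMod 3, (∏ g ∈ range n, bfz bell (0 + g) (E + posZ u g)) * vE bell n E (E + posZ u n) := by
    intro u
    rw [Finset.sum_eq_single (posZ u n + 2)]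
    · unfold vE
      rw [if_pos ((twist_iff _ _).2 rfl), Finset.prod_range_succ]
      congr 1
      · refine Finset.prod_congr rfl fun g _ => ?_
        rw [Nat.zero_add]; congr 1; ring
      · congr 1; ring
    · intro E _ hE
      unfold vE
      rw [if_neg (fun h => hE ((twist_iff _ _).1 h)), mul_zero]
    · intro h; exact absurd (mem_univ _) h
  simp only [hins]
  rw [Finset.sum_comm, Finset.mul_sum]
  refine Finset.sum_congr rfl fun E _ => ?_
  have h := pathSum bell n 0 E (vE bell n E)
  exact h

end TransferWalk

end Summit.QuantumAdvantage.AdviceFreeQNC0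

end
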